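import Summits.HubbardSuperconductivity.HubbardSuperconductivity.Theorems.AnisotropyChordTransferFibre3KT1Targets
import Summits.HubbardSuperconductivity.HubbardSuperconductivity.Theorems.AnisotropyChordTransferFibre3TauTailBound
import Summits.HubbardSuperconductivity.HubbardSuperconductivity.Theorems.AnisotropyChordTransferFibre3Lam2Bounds
import Summits.HubbardSuperconductivity.HubbardSuperconductivity.Theorems.AnisotropyChordTransferFibre3GroundState
import Summits.HubbardSuperconductivity.HubbardSuperconductivity.Theorems.AnisotropyChordTransferFibre3PiFourier

/-!
# Route `AnisotropyChord` / H0 rotor rung: PartN33 Layer C, T3(i) — `TtailBounds` PROVED (`L ≥ 3`, `0 ≤ Δ`)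

PartN33 = `…Fibre3KT1Targets` (theory seat `hubbard-h0-rotor-theory-1`, memo 21 §298(a)), the tail toolkit T3(i):
for the small part `s` of the pair function, `t(k) = Re FT[s²](k)` satisfies, for `k ≠ 0`,
`−2Δ f_nn c_s g(k)/V ≤ t(k) ≤ min(‖s‖², 2c_s² G(0)/(ε(k) − 2λ₂))`, `g = 1/(2ε − λ₂)`.

Proof (all finite lattice sums over the tree definitions):
* `dft_sfun'` — `ŝ(k) = c_s·g(k)` for `k ≠ 0` and `ŝ(0) = −Δ f_nn` (`TwoMagnonFourier`, `FT[1] = V·δ`, `FT[δ₀] = 1`);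
* `fsqFourier_holds` — `FT[s²](k) = (1/V) Σ_p ŝ(p) ŝ(k − p)`; the terms `p = 0`, `p = k` give `−2Δ f_nn c_s g(k)/V`, the rest is
  `(c_s²/V) Σ_{p ∉ {0,k}} g(p) g(k−p) ≥ 0` (lower bound; `g > 0` off the origin since `λ₂ < 2ε₁`);
* `t(k) ≤ Σ s²` is `re_dft_le_sum` (`…TauTailBound`);
* `epsT_add_le` — `ε(p + q) ≤ 2ε(p) + 2ε(q)` (`|1 − zw|² ≤ 2|1 − z|² + 2|1 − w|²` for unit `z, w`), whence
  `g(p)g(k−p) ≤ (g(p) + g(k−p))/(ε(k) − 2λ₂)` and `Σ_{p ∉ {0,k}} g(p)g(k−p) ≤ 2V·G(0)/(ε(k) − 2λ₂)`; with `0 ≤ Δ` the pole term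
  `−2Δ f_nn c_s g(k)/V` is `≤ 0`, which gives the third bound.

Hypotheses: `3 ≤ L` (distinct neighbour vectors: `TwoMagnonFourier`, sum rule) and `0 ≤ Δ` (sign of the pole term in the
upper bound; the physical range of the reduction is `0 ≤ Δ < 1`).  Nothing here proves superconductivity in the Hubbard
model; these are helper lemmas of ONE conditional reduction (rung stmt-HubbardSuperconductivity-19089).
Prover seat `hubbard-h0-rotor-p3` g0; `--supports stmt-HubbardSuperconductivity-19089`.
-/

set_option linter.dupNamespace false
set_option autoImplicit false

noncomputable section

open scoped BigOperators
open Complex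

namespace Summit.HubbardSuperconductivity.HubbardSuperconductivity.Theorems.AnisotropyChord.Transfer.Fibre3

variable (L : ℕ) [NeZero L]

/-! ## The lattice inequality `ε(p + q) ≤ 2ε(p) + 2ε(q)` -/

/-- `Re e^{ik·ŷ} = cos(2π k_y/L)`. [folklore] -/
theorem phase_ey_re (k : Tor L) : (phase L k (ey L)).re = Real.cos (2 * Real.pi * k.2.val / L) := by
  rw [phase_ey, show (2 * (Real.pi : ℂ) * Complex.I * (((k.2.val : ℕ) : ℂ) / (L : ℂ)))
      = ((2 * Real.pi * k.2.val / L : ℝ) : ℂ) * Complex.I by push_cast; ring, Complex.exp_ofReal_mul_I_re]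

/-- `ε(k) = (1 − Re e^{ik·x̂}) + (1 − Re e^{ik·ŷ})`. [folklore] -/
theorem epsT_eq_re (k : Tor L) : epsT L k = (1 - (phase L k (ex L)).re) + (1 - (phase L k (ey L)).re) := by
  rw [phase_ex_re, phase_ey_re]; unfold epsT; ring

/-- for unit complex numbers `z, w`: `1 − Re(zw) ≤ 2(1 − Re z) + 2(1 − Re w)`
(`|1 − zw|² ≤ 2|1 − z|² + 2|1 − w|²`). [folklore] -/
theorem one_sub_re_mul_le {z w : ℂ} (hz : Complex.normSq z = 1) (hw : Complex.normSq w = 1) :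
    1 - (z * w).re ≤ 2 * (1 - z.re) + 2 * (1 - w.re) := by
  rw [Complex.normSq_apply] at hz hw
  have ha : z.re ≤ 1 := by nlinarith [sq_nonneg z.im]
  have hc : w.re ≤ 1 := by nlinarith [sq_nonneg w.im]
  rw [Complex.mul_re]
  nlinarith [mul_nonneg (sub_nonneg.mpr ha) (sub_nonneg.mpr hc), sq_nonneg (z.im - w.im),
    sq_nonneg (1 - z.re), sq_nonneg (1 - w.re)]

/-- **`ε(p + q) ≤ 2ε(p) + 2ε(q)`.** [folklore] -/
theorem epsT_add_le (p q : Tor L) : epsT L (p + q) ≤ 2 * epsT L p + 2 * epsT L q := by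
  rw [epsT_eq_re, epsT_eq_re L p, epsT_eq_re L q, phase_add_left, phase_add_left]
  have h1 := one_sub_re_mul_le (normSq_phase L p (ex L)) (normSq_phase L q (ex L))
  have h2 := one_sub_re_mul_le (normSq_phase L p (ey L)) (normSq_phase L q (ey L))
  linarith

/-- the resolvent inequality: for `x, y > 0` with `m ≤ x + y`, `m > 0`: `(1/x)(1/y) ≤ (1/x + 1/y)/m`. [folklore] -/
theorem inv_mul_inv_le {x y m : ℝ} (hx : 0 < x) (hy : 0 < y) (hm : 0 < m) (hxy : m ≤ x + y) :
    1 / x * (1 / y) ≤ (1 / x + 1 / y) / m := by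
  rw [le_div_iff₀ hm]
  have ha : 1 / x * x = 1 := by field_simp
  have hb : 1 / y * y = 1 := by field_simp
  have hgp : 0 < 1 / x := one_div_pos.mpr hx
  have hgq : 0 < 1 / y := one_div_pos.mpr hy
  calc 1 / x * (1 / y) * m
      ≤ 1 / x * (1 / y) * (x + y) := mul_le_mul_of_nonneg_left hxy (mul_pos hgp hgq).le
    _ = 1 / x + 1 / y := by linear_combination (1 / y) * ha + (1 / x) * hb

/-! ## The Fourier transform of the small part `s` -/

/-- `Σ_r conj φ_q(r) = V·[q = 0]`. [folklore] -/
theorem sum_conj_phase_right (q : Tor L) :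
    ∑ r : Tor L, (starRingEnd ℂ) (phase L q r) = if q = 0 then ((L : ℂ) ^ 2) else 0 := by
  rw [← map_sum, sum_phase_right]
  split_ifs
  · rw [map_pow, map_natCast]
  · rw [map_zero]

/-- **the Fourier transform of `s`:** `ŝ(0) = −Δ f_nn` and `ŝ(q) = c_s/(2ε(q) − λ₂)` for `q ≠ 0`
(`L ≥ 3`, `λ₂ < 2ε₁`). [folklore] -/
theorem dft_sfun' (hL : 3 ≤ L) {Δ lam2 : ℝ} {f : Tor L → ℝ} (hf : IsTwoMagnon L Δ lam2 f)
    (hl2 : lam2 < 2 * eps1 L) (q : Tor L) :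
    dft L (sfun' L Δ f) q
      = (((if q = 0 then -(Δ * f (K1 L)) else cS L Δ lam2 f / (2 * epsT L q - lam2)) : ℝ) : ℂ) := by
  classical
  have hL2 : 2 ≤ L := by omega
  obtain ⟨h0, hnn, _, hsum, heq⟩ := hf
  have hF := twoMagnonFourier_holds L hL Δ lam2 f h0 hnn heq
  -- expand `s = 1 − f − Δ f_nn δ₀`
  have sall : ∀ r : Tor L, sfun' L Δ f r = 1 - f r - (if r = 0 then Δ * f (K1 L) else 0) := by
    intro r
    simp only [sfun']
    by_cases hr : r = 0
    · rw [if_pos hr, if_pos hr, hr, h0]; ring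
    · rw [if_neg hr, if_neg hr]; ring
  have e1 : dft L (sfun' L Δ f) q
      = (∑ r : Tor L, (starRingEnd ℂ) (phase L q r)) - dft L f q - ((Δ * f (K1 L) : ℝ) : ℂ) := by
    unfold dft
    have hpt : ∀ r : Tor L, (starRingEnd ℂ) (phase L q r) * ((sfun' L Δ f r : ℝ) : ℂ)
        = (starRingEnd ℂ) (phase L q r) - (starRingEnd ℂ) (phase L q r) * ((f r : ℝ) : ℂ)
          - (if r = 0 then (starRingEnd ℂ) (phase L q r) * ((Δ * f (K1 L) : ℝ) : ℂ) else 0) := by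
      intro r; rw [sall r]; split_ifs <;> push_cast <;> ring
    rw [Finset.sum_congr rfl fun r _ => hpt r, Finset.sum_sub_distrib, Finset.sum_sub_distrib,
      Finset.sum_ite_eq' Finset.univ (0 : Tor L)]
    simp only [Finset.mem_univ, if_true]
    rw [phase_zero, map_one, one_mul]
  rw [e1, sum_conj_phase_right]
  by_cases hq : q = 0
  · rw [if_pos hq, if_pos hq, hq, dft_zero, hsum]
    push_cast; ring
  · rw [if_neg hq, if_neg hq]
    have hc : 0 < 2 * epsT L q - lam2 := by have := eps1_le_epsT L hL2 hq; linarith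
    have hcC : ((2 * epsT L q - lam2 : ℝ) : ℂ) ≠ 0 := by exact_mod_cast hc.ne'
    have e3 : dft L f q = -((f (K1 L) * (4 * (1 - Δ) + 2 * Δ * epsT L q) : ℝ) : ℂ)
        / ((2 * epsT L q - lam2 : ℝ) : ℂ) := by
      rw [eq_div_iff hcC, mul_comm]; exact hF q
    rw [e3]
    unfold cS
    rw [Complex.ofReal_div, eq_div_iff hcC]
    field_simp
    push_cast
    ring

/-! ## `TtailBounds` -/

/-- ★ **`TtailBounds L Δ` holds for `L ≥ 3` and `0 ≤ Δ`.** [folklore] -/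
theorem ttailBounds_holds (hL : 3 ≤ L) {Δ : ℝ} (hΔ : 0 ≤ Δ) : TtailBounds L Δ := by
  classical
  intro lam2 f hf hl0 hl2 k hk
  have hL2 : 2 ≤ L := by omega
  have htm := hf.1
  have hpos : 0 < f (K1 L) := htm.2.2.1
  have hrule := lam2_sum_rule L hL htm
  have heps1 : 0 < eps1 L := by linarith
  have hl2' : lam2 < 2 * eps1 L := by linarith
  set V : ℝ := (L : ℝ) ^ 2 with hV
  have hVpos : 0 < V := by
    have : (0 : ℝ) < L := by exact_mod_cast (show 0 < L by omega)
    positivity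
  set fnn : ℝ := f (K1 L) with hfnn
  set cs : ℝ := cS L Δ lam2 f with hcs_def
  have hcs : cs = fnn * (4 * (1 - Δ) + Δ * lam2) := rfl
  -- positivity of the resolvent off the origin
  have hck : ∀ q : Tor L, q ≠ 0 → 0 < 2 * epsT L q - lam2 := by
    intro q hq; have := eps1_le_epsT L hL2 hq; linarith
  have hm : 0 < epsT L k - 2 * lam2 := by have := eps1_le_epsT L hL2 hk; linarith
  have h1Δ : 0 < 1 - Δ := by
    have h4 : 0 < 4 * (1 - Δ) * fnn := by rw [← hrule]; exact mul_pos hl0 hVpos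
    nlinarith
  have hcs0 : 0 ≤ cs := by
    rw [hcs]; apply mul_nonneg hpos.le; nlinarith [mul_nonneg hΔ hl0.le]
  set g : Tor L → ℝ := fun q => 1 / (2 * epsT L q - lam2) with hg
  have hgpos : ∀ q : Tor L, q ≠ 0 → 0 < g q := fun q hq => by simp only [hg]; exact one_div_pos.mpr (hck q hq)
  -- the Fourier transform of `s`
  set shat : Tor L → ℝ := fun q => if q = 0 then -(Δ * fnn) else cs * g q with hshat
  have hdft_s : ∀ q : Tor L, dft L (sfun' L Δ f) q = ((shat q : ℝ) : ℂ) := by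
    intro q
    rw [dft_sfun' L hL htm hl2' q]
    simp only [hshat, hg]
    split_ifs <;> push_cast <;> ring
  have sh0 : shat 0 = -(Δ * fnn) := by simp [hshat]
  have shk : shat k = cs * g k := by simp [hshat, hk]
  -- `t(k)` as a real one-loop sum
  have ht : tfun L Δ f k = (∑ p : Tor L, shat p * shat (k - p)) / V := by
    unfold tfun
    rw [fsqFourier_holds L (sfun' L Δ f) k]
    simp only [hdft_s]
    have : (∑ p : Tor L, ((shat p : ℝ) : ℂ) * ((shat (k - p) : ℝ) : ℂ)) / ((L : ℂ) ^ 2)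
        = ((((∑ p : Tor L, shat p * shat (k - p)) / V : ℝ)) : ℂ) := by
      rw [hV]; push_cast; rfl
    rw [this, Complex.ofReal_re]
  -- split off the two pole terms `p = 0`, `p = k`
  set R : Finset (Tor L) := ((Finset.univ : Finset (Tor L)).erase 0).erase k with hR
  have hkmem : k ∈ (Finset.univ : Finset (Tor L)).erase 0 := Finset.mem_erase.mpr ⟨hk, Finset.mem_univ _⟩
  have memR : ∀ p : Tor L, p ∈ R → p ≠ 0 ∧ k - p ≠ 0 := by
    intro p hp
    rw [hR] at hp
    have hpk : p ≠ k := Finset.ne_of_mem_erase hp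
    have hp0 : p ≠ 0 := Finset.ne_of_mem_erase (Finset.mem_of_mem_erase hp)
    exact ⟨hp0, sub_ne_zero.mpr (Ne.symm hpk)⟩
  have hsplit : ∑ p : Tor L, shat p * shat (k - p)
      = -(2 * Δ * fnn * cs * g k) + cs ^ 2 * ∑ p ∈ R, g p * g (k - p) := by
    rw [← Finset.add_sum_erase _ _ (Finset.mem_univ (0 : Tor L)), ← Finset.add_sum_erase _ _ hkmem]
    have hR' : ∀ p ∈ R, shat p * shat (k - p) = cs ^ 2 * (g p * g (k - p)) := by
      intro p hp
      obtain ⟨hp0, hkp⟩ := memR p hp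
      simp only [hshat, if_neg hp0, if_neg hkp]; ring
    rw [Finset.sum_congr rfl hR', ← Finset.mul_sum, sub_zero, sub_self, sh0, shk]
    ring
  have hSR : 0 ≤ ∑ p ∈ R, g p * g (k - p) :=
    Finset.sum_nonneg fun p hp => (mul_pos (hgpos p (memR p hp).1) (hgpos (k - p) (memR p hp).2)).le
  refine ⟨?_, ?_, ?_⟩
  · -- (a) the lower bound: drop the non-negative rest
    rw [ht, hsplit]
    have : -(2 * Δ * fnn * cs / (2 * epsT L k - lam2)) = -(2 * Δ * fnn * cs * g k) := by
      simp only [hg]; ring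
    rw [this]
    apply div_le_div_of_nonneg_right _ hVpos.le
    nlinarith [mul_nonneg (sq_nonneg cs) hSR]
  · -- (b) `t(k) ≤ ‖s‖²`
    unfold tfun
    exact re_dft_le_sum L (fun r => sq_nonneg _) k
  · -- (c) the resolvent bound
    rw [ht, hsplit]
    have hpair : ∀ p ∈ R, g p * g (k - p) ≤ (g p + g (k - p)) / (epsT L k - 2 * lam2) := by
      intro p hp
      obtain ⟨hp0, hkp⟩ := memR p hp
      have hxy : epsT L k - 2 * lam2 ≤ (2 * epsT L p - lam2) + (2 * epsT L (k - p) - lam2) := by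
        have h := epsT_add_le L p (k - p)
        rw [show p + (k - p) = k by abel] at h
        linarith
      simp only [hg]
      exact inv_mul_inv_le (hck p hp0) (hck (k - p) hkp) hm hxy
    have hS1 : ∑ p ∈ R, g p * g (k - p)
        ≤ (∑ p ∈ R, g p + ∑ p ∈ R, g (k - p)) / (epsT L k - 2 * lam2) := by
      rw [← Finset.sum_add_distrib, Finset.sum_div]
      exact Finset.sum_le_sum hpair
    have hrefl : ∑ p ∈ R, g (k - p) = ∑ p ∈ R, g p := by
      refine Finset.sum_equiv (Equiv.subLeft k) (fun p => ?_) (fun p _ => rfl)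
      rw [hR]
      simp only [Finset.mem_erase, Finset.mem_univ, and_true, Equiv.subLeft_apply]
      constructor
      · rintro ⟨h1, h2⟩
        exact ⟨fun h => h2 (sub_eq_self.mp h), sub_ne_zero.mpr (Ne.symm h1)⟩
      · rintro ⟨h1, h2⟩
        refine ⟨fun h => h2 (by rw [h, sub_self]), fun h => h1 (by rw [h, sub_zero])⟩
    have hsub : ∑ p ∈ R, g p ≤ ∑ p ∈ (Finset.univ : Finset (Tor L)).erase 0, g p := by
      refine Finset.sum_le_sum_of_subset_of_nonneg (by rw [hR]; exact Finset.erase_subset _ _) ?_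
      intro p hp _
      exact (hgpos p (Finset.ne_of_mem_erase hp)).le
    have hG : ∑ p ∈ (Finset.univ : Finset (Tor L)).erase 0, g p = V * Gzero L lam2 := by
      unfold Gzero
      rw [← hV]
      simp only [hg]
      field_simp
    have hS : ∑ p ∈ R, g p * g (k - p) ≤ 2 * (V * Gzero L lam2) / (epsT L k - 2 * lam2) := by
      rw [← hG]
      refine hS1.trans ?_
      rw [hrefl]
      exact div_le_div_of_nonneg_right (by linarith [hsub]) hm.le
    have hfirst : 0 ≤ 2 * Δ * fnn * cs * g k := by
      have := hgpos k hk; positivity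
    rw [div_le_iff₀ hVpos]
    have h2 : cs ^ 2 * ∑ p ∈ R, g p * g (k - p) ≤ cs ^ 2 * (2 * (V * Gzero L lam2) / (epsT L k - 2 * lam2)) :=
      mul_le_mul_of_nonneg_left hS (sq_nonneg _)
    have e : cs ^ 2 * (2 * (V * Gzero L lam2) / (epsT L k - 2 * lam2))
        = 2 * cs ^ 2 * Gzero L lam2 / (epsT L k - 2 * lam2) * V := by ring
    linarith

end Summit.HubbardSuperconductivity.HubbardSuperconductivity.Theorems.AnisotropyChord.Transfer.Fibre3

end
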